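import Mathlib
import Summits.Ventures.HodgeRepro.Tier4.Common.AdelicDefs
import Summits.Ventures.HodgeRepro.Tier4.Common.AdelicHaar
import Summits.Ventures.HodgeRepro.Tier4.Common.SettingOfData
import Summits.Ventures.HodgeRepro.Tier4.Common.MixedPlane
import Summits.Ventures.HodgeRepro.Tier4.Common.RowWeights
import Summits.Ventures.HodgeRepro.Tier4.Common.TorusPathAdeles
import Summits.Ventures.HodgeRepro.Tier4.Common.TorusPath
import Summits.Ventures.HodgeRepro.Tier4.Common.LpInfiniteOfHaar
import Summits.Ventures.HodgeRepro.Tier4.Line4.CMPlaceBridge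
import Summits.Ventures.HodgeRepro.Tier4.Line4.LpInfiniteDisplay

/-!
# Tier4/Line4/LpInfiniteHolds — display (10) `l4_lpInfinite` CLOSED BY NAME

Blind re-derivation cell `pub-hodge-repro`, Tier 4 «PROVE THE STEP» (README §9–§10), LINE L4, seat t4-L3-p1 (gen 3),
cut C-L4-LPINF (plan-4 S15084 / lead S15050): the one-line glue.  `lpInfinite_of_nonDiscrete` (LpInfiniteDisplay
p703184) needs `hnd : (𝓝[≠] 1).NeBot` on `G(𝔸)` of the seesaw plane; typer-2 g4's
`nhdsWithin_compl_singleton_neBot_seesaw_of_forall` (TorusPath p704330: the archimedean torus path `θ ↦ e^{iθ}` at a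
real CM place) gives it from «every place of `k` is real» and «`IsCMAt q w` at every place», which on `k = E⁺` are the
bridge lemmas `isReal_of_kOf` / `isCMAt_of_describesCM` (CMPlaceBridge p700356) from `q` describing `E/E⁺`.

`l4_lpInfinite_holds` is the skeleton's display (10) VERBATIM on `k = ↥(maximalRealSubfield E)` with `seesawPlane`
unfolded (`(PlaneData.mixedRow q (a 0) (a 2)).withTransportedTorus g g' hgg' hg'g hgΩ`) and `DescribesCM q` unfolded;
binders = the display's own (the unused `_hR` dropped) plus the CM description.

Imports: Mathlib and the Tier-4 modules named above, by name.  `#print axioms` = `[propext, Classical.choice,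
Quot.sound]`.  No printed input is consumed.  Nothing here asserts anything about the truth of (P); HC_CM is NOT proved
by anyone in this repository.
-/

set_option autoImplicit false

noncomputable section

namespace Summit.Ventures.HodgeRepro.Tier4.Line4

open Summit.Ventures.HodgeRepro.Tier4.Common MeasureTheory NumberField

/-- **Display (10) of the L4 skeleton, a theorem**: `L²(D_G)` of the setting of the defined objects on the seesaw plane
over `k = E⁺` is infinite-dimensional, for `q` describing `E/E⁺`. -/
theorem l4_lpInfinite_holds {E : Type} [Field E] [NumberField E] [IsCMField E]
    (q : QuadData ↥(maximalRealSubfield E))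
    (hq : ∃ ω : E, ω ^ 2 = algebraMap ↥(maximalRealSubfield E) E q.t * ω - algebraMap ↥(maximalRealSubfield E) E q.n ∧
      IsCMField.complexConj E ω = algebraMap ↥(maximalRealSubfield E) E q.t - ω ∧ IsCMField.complexConj E ω ≠ ω)
    (a : Fin 4 → ↥(maximalRealSubfield E)) (g g' : Matrix (Fin 4) (Fin 4) ↥(maximalRealSubfield E))
    (hgg' : g * g' = 1) (hg'g : g' * g = 1)
    (hgΩ : g * (PlaneData.mixedRow q (a 0) (a 2)).Ω = (PlaneData.mixedRow q (a 0) (a 2)).Ω * g)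
    [MeasurableSpace (GA ((PlaneData.mixedRow q (a 0) (a 2)).withTransportedTorus g g' hgg' hg'g hgΩ))]
    [BorelSpace (GA ((PlaneData.mixedRow q (a 0) (a 2)).withTransportedTorus g g' hgg' hg'g hgΩ))]
    (R : RTFData ((PlaneData.mixedRow q (a 0) (a 2)).withTransportedTorus g g' hgg' hg'g hgΩ))
    (μ : Measure (GA ((PlaneData.mixedRow q (a 0) (a 2)).withTransportedTorus g g' hgg' hg'g hgΩ)))
    [μ.IsHaarMeasure] [R.μT.IsHaarMeasure] [R.μT'.IsHaarMeasure]
    (DG : Set (GA ((PlaneData.mixedRow q (a 0) (a 2)).withTransportedTorus g g' hgg' hg'g hgΩ)))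
    (fdG : IsFundamentalDomain
      (rationalPoints ((PlaneData.mixedRow q (a 0) (a 2)).withTransportedTorus g g' hgg' hg'g hgΩ)) DG μ)
    (compG : IsCompact (closure DG)) (compT : IsCompact (closure R.DT)) (compT' : IsCompact (closure R.DT')) :
    ¬ FiniteDimensional ℂ (Lp ℂ 2
      ((Setting.ofAdelicData ((PlaneData.mixedRow q (a 0) (a 2)).withTransportedTorus g g' hgg' hg'g hgΩ)
          R μ DG fdG compG compT compT').μ.restrict
        (Setting.ofAdelicData ((PlaneData.mixedRow q (a 0) (a 2)).withTransportedTorus g g' hgg' hg'g hgΩ)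
          R μ DG fdG compG compT compT').DG)) :=
  lpInfinite_of_nonDiscrete _ R μ DG fdG compG compT compT'
    (nhdsWithin_compl_singleton_neBot_seesaw_of_forall q a g g' hgg' hg'g hgΩ (isReal_of_kOf E)
      (isCMAt_of_describesCM q hq))

end Summit.Ventures.HodgeRepro.Tier4.Line4

end
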